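import Summits.CriticalPhenomena.PercolationContinuityZ3.Theorems.PercNearOneGluingNoHeavyLowerTailKnQuestion8CoefficientwiseRemSPBase
import Summits.CriticalPhenomena.PercolationContinuityZ3.Theorems.PercNearOneGluingNoHeavyLowerTailKnQuestion8CoefficientwiseRemSPSeries
import Summits.CriticalPhenomena.PercolationContinuityZ3.Theorems.PercNearOneGluingNoHeavyLowerTailKnQuestion8CoefficientwiseRemSPParallel
import HarnessLib

/-!
# THEOREM SP: CONJECTURE (REM) holds for every target set on every series–parallel root block — prim-lf-2 gen 69

Support/definition file (`--supports stmt-CriticalPhenomena-4575`, closed), prover `prim-lf-2` (gen 69).  One inductive predicate + theorems; no named facts, no sorries;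
standard axioms.  Memo `prim-lf-2/CW-SP-gen69.md` (THEOREM SP = §5, THEOREM U3-CLOSURE = §4.2, THEOREM 0 = §2).

Setting (CONJECTURE (REM), prim-lf-2 gens 66–69): multigraph `ends : ι → Sym2 V`, root `x`, root edge `e ∈ E` with ends `{x,p}`, target set `W`,
`REM_E(e;x,W)[g] = Σ_{s ⊆ E : e ∈ s, ∀ w∈W ¬(w ∈ C_x s ∧ w ∈ C_x(E∖s))} (g(C_x s) − g(C_x(E∖s)))`.
* `Coefficientwise.IsSP2T ends D x h` — `D` is a TWO-TERMINAL SERIES–PARALLEL edge set with terminals `x ≠ h`: a single edge `{e₀}` with ends `{x,h}`, or a series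
  composition `D₁ ∪ D₂` of `(D₁;x,m)` and `(D₂;m,h)` (disjoint, sharing only the junction `m`, `x ∉ D₂`-edges, `h ∉ D₁`-edges), or a parallel composition of
  `(D₁;x,h)` and `(D₂;x,h)` (disjoint, sharing only `x, h`).
* `Coefficientwise.inU3_of_isSP2T` — **THEOREM U3-CLOSURE ⇒ every two-terminal series–parallel piece is in 𝒰** (`inU3_singleton`, `inU3_series`, `inU3_parallel`).
* `Coefficientwise.rem_nonneg_seriesParallel` — **THEOREM SP**: if `E ∖ e` is two-terminal series–parallel with terminals the ends `x, p` of the root edge `e`, then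
  `0 ≤ REM_E(e; x, W)[g]` for EVERY target set `W` and every monotone `g` (via `rem_nonneg_of_inU3`, i.e. THEOREM 0).  With the cut-vertex identity
  (`rem_nonneg_oneSum`, gen 68) this gives (REM) whenever the root-edge block is `K₄`-minor-free.
[cite: KozmaNitzan2024, Questions 8–9 (§5.5 p. 36) (context: the Question-8 pocket covariance programme)]
-/

namespace Summit.CriticalPhenomena.PercolationContinuityZ3.Theorems

open Finset Literature.Probability.Percolation

namespace Coefficientwise

variable {ι V : Type*} [DecidableEq ι]

/-- Two-terminal series–parallel edge sets `(D; x, h)` of the multigraph `ends`, built from single edges by series and parallel composition. -/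
inductive IsSP2T (ends : ι → Sym2 V) : Finset ι → V → V → Prop
  | edge {e₀ : ι} {x h : V} (he : ends e₀ = s(x, h)) (hxh : x ≠ h) : IsSP2T ends {e₀} x h
  | series {D₁ D₂ : Finset ι} {x m h : V} (hdisj : Disjoint D₁ D₂) (hxm : x ≠ m) (hmh : m ≠ h) (hxh : x ≠ h)
      (hsep : ∀ e ∈ D₁, ∀ e' ∈ D₂, ∀ w : V, w ∈ ends e → w ∈ ends e' → w = m)
      (hxD₂ : ∀ e ∈ D₂, x ∉ ends e) (hhD₁ : ∀ e ∈ D₁, h ∉ ends e)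
      (h₁ : IsSP2T ends D₁ x m) (h₂ : IsSP2T ends D₂ m h) : IsSP2T ends (D₁ ∪ D₂) x h
  | parallel {D₁ D₂ : Finset ι} {x h : V} (hdisj : Disjoint D₁ D₂) (hxh : x ≠ h)
      (hsep : ∀ e ∈ D₁, ∀ e' ∈ D₂, ∀ w : V, w ∈ ends e → w ∈ ends e' → w = x ∨ w = h)
      (h₁ : IsSP2T ends D₁ x h) (h₂ : IsSP2T ends D₂ x h) : IsSP2T ends (D₁ ∪ D₂) x h

variable (ends : ι → Sym2 V)

/-- **THEOREM U3-CLOSURE, assembled: every two-terminal series–parallel piece is in 𝒰.** [cite: KozmaNitzan2024, Questions 8–9 (§5.5 p. 36) (context)] -/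
theorem inU3_of_isSP2T {D : Finset ι} {x h : V} (hsp : IsSP2T ends D x h) : InU3 ends D x h := by
  induction hsp with
  | edge he hxh => exact inU3_singleton ends he hxh
  | series hdisj hxm hmh hxh hsep hxD₂ hhD₁ _ _ ih₁ ih₂ => exact inU3_series ends hdisj hxm hmh hxh hsep hxD₂ hhD₁ ih₁ ih₂
  | parallel hdisj hxh hsep _ _ ih₁ ih₂ => exact inU3_parallel ends hdisj hxh hsep ih₁ ih₂

open Classical in
/-- **THEOREM SP (prim-lf-2 gen 69).**  Let `e ∈ E` be a root edge with ends `{x,p}`, `p ≠ x`, such that `E ∖ e` is a two-terminal series–parallel edge set with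
terminals `x, p`.  Then for every target set `W` and every monotone `g`:
`0 ≤ REM_E(e; x, W)[g] = Σ_{s ⊆ E : e ∈ s, ∀ w∈W ¬(w ∈ C_x s ∧ w ∈ C_x(E∖s))} (g(C_x s) − g(C_x(E∖s)))`.
[cite: KozmaNitzan2024, Questions 8–9 (§5.5 p. 36) (context)] -/
theorem rem_nonneg_seriesParallel (E : Finset ι) {e : ι} (he : e ∈ E) {x p : V} (hxp : ends e = s(x, p)) (hpx : p ≠ x)
    (hsp : IsSP2T ends (E.erase e) x p) (W : Set V) (g : Set V → ℝ) (hg : Monotone g) :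
    0 ≤ ∑ s ∈ E.powerset.filter (fun s : Finset ι => e ∈ s ∧
          ∀ w ∈ W, ¬ (w ∈ openCluster (ends '' (↑s : Set ι)) x ∧ w ∈ openCluster (ends '' (↑(E \ s) : Set ι)) x)),
      (g (openCluster (ends '' (↑s : Set ι)) x) - g (openCluster (ends '' (↑(E \ s) : Set ι)) x)) :=
  rem_nonneg_of_inU3 ends E he hxp hpx (inU3_of_isSP2T ends hsp) W g hg

end Coefficientwise

end Summit.CriticalPhenomena.PercolationContinuityZ3.Theorems
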